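import Summits.SmoothPoincare4.SmoothPoincare4.Theorems.EntropyRungChangGurskyYangStubSmoothRoundLimitAux4
import HarnessLib

/-!
# The scaled Ricci flow read in a chart, III: the package for the stub (Hamilton 1982, §14 and §17)
(helper file 5 for stub `stub_smoothRoundLimit`, line `margerin-cone-hamilton-rails`, crux
`EntropyRung.ChangGurskyYang`, item stmt-SmoothPoincare4-10834)

The `4`-dimensional Euclidean model of the stub: `normSq_sub_two_mul_ricci_le`
(`|g − 2(T−t)Ric|²_g ≤ (C² + 4C)(T−t)^{2δ}` from the two roundness rates,
`normSq_toBilinForm_sub_smul`) and the registered package `helper_scaledChartBounds` of the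
order-zero chart bounds of the scaled flow `g(t)/(T−t)` on a closed chart ball: two-sided bounds,
convergence in operator norm with the rate `(T−t)^δ` to symmetric uniformly positive limit forms
(the envelope being `helper_scaledMetric_tendsto`), bounded components of all `∇ᵏRic`, and the
velocity bound `|G_t − 2(T−t)Ric(G_t)| ≤ C₀ (T−t)^{1+δ}`.

## References

* R. S. Hamilton, *Three-manifolds with positive Ricci curvature*, J. Differential Geom. 17
  (1982) 255–306, §14, Lemma 14.2; §17, Thm. 17.6. [Hamilton1982]
* P. Topping, *Lectures on the Ricci flow*, LMS Lecture Note Series 325, CUP 2006, §5.3,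
  proof of Thm. 5.3.1, p. 47; Thm. 3.3.1. [Topping2006]
* A. L. Besse, *Einstein manifolds*, Springer 1987, 1.118. [Besse1987]
-/

noncomputable section

-- every `Summit.SmoothPoincare4.SmoothPoincare4.…` name repeats the summit = sub-problem segment (D-0017 layout)
set_option linter.dupNamespace false

-- operator spaces of bilinear forms over the model space
set_option maxSynthPendingDepth 3

open Set Function Filter Real Module Metric
open scoped Manifold ContDiff Topology

namespace Summit.SmoothPoincare4.SmoothPoincare4.Theorems.MargerinRails

open Literature.Geometry.Riemannian
open Literature.Geometry.Lorentzian Literature.Geometry.Lorentzian.PseudoRiemannianMetric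
open Literature.Geometry.Lorentzian.MetricCoord

universe u v w

/-! ### The `4`-dimensional Euclidean model of the stub -/

section Euclidean

variable {M : Type} [TopologicalSpace M] [ChartedSpace (EuclideanSpace ℝ (Fin 4)) M]
  [IsManifold (𝓡 4) ∞ M]
  {g : ℝ → PseudoRiemannianMetric (𝓡 4) ∞ (EuclideanSpace ℝ (Fin 4)) (TangentSpace (𝓡 4) : M → Type _)}
  {cov : ℝ → CovariantDerivative (𝓡 4) (EuclideanSpace ℝ (Fin 4)) (TangentSpace (𝓡 4) : M → Type _)}
  {T δ C t₀ : ℝ}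

/-- **The velocity of the scaled metric from the two roundness rates**:
`|g − 2(T−t)Ric|²_g = ((T−t)R − 2)² + 4(T−t)²|E|² ≤ (C² + 4C)(T−t)^{2δ}`
(`normSq_toBilinForm_sub_smul`). [cite: Hamilton1982, §17, Thm. 17.6] -/
theorem normSq_sub_two_mul_ricci_le (hR : ∀ t ∈ Ico 0 T, (g t).IsRiemannian) (ht₀ : t₀ ∈ Ico 0 T)
    (hrate : ∀ t ∈ Ico t₀ T, ∀ x : M,
      |(T - t) * (g t).scalarCurvatureWith (cov t) x - 2| ≤ C * (T - t) ^ δ ∧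
      (T - t) ^ 2 * ((g t).normSq x ((cov t).ricci x) -
        (g t).scalarCurvatureWith (cov t) x ^ 2 / 4) ≤ C * (T - t) ^ (2 * δ)) :
    ∀ t ∈ Ico t₀ T, ∀ x : M,
      (g t).normSq x ((g t).toBilinForm x - (2 * (T - t)) • ((cov t).ricci x)) ≤
        (C ^ 2 + 4 * C) * (T - t) ^ (2 * δ) := by
  intro t ht x
  have hTt : 0 < T - t := sub_pos.2 ht.2
  have h4 : finrank ℝ (EuclideanSpace ℝ (Fin 4)) = 4 := finrank_euclideanSpace_fin
  obtain ⟨h₁, h₂⟩ := hrate t ht x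
  have hid := normSq_toBilinForm_sub_smul (g t) (hR t ⟨ht₀.1.trans ht.1, ht.2⟩) h4 x ((cov t).ricci x)
    (2 * (T - t))
  rw [hid]
  have htr : (g t).trace x ((cov t).ricci x) = (g t).scalarCurvatureWith (cov t) x := rfl
  rw [htr]
  have h2δ : (T - t) ^ (2 * δ) = ((T - t) ^ δ) ^ 2 := by rw [mul_comm, rpow_mul hTt.le, rpow_two]
  rw [h2δ] at h₂ ⊢
  have hsq : ((T - t) * (g t).scalarCurvatureWith (cov t) x - 2) ^ 2 ≤ (C * (T - t) ^ δ) ^ 2 := by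
    have h0 : 0 ≤ C * (T - t) ^ δ := (abs_nonneg _).trans h₁
    nlinarith [abs_nonneg ((T - t) * (g t).scalarCurvatureWith (cov t) x - 2),
      sq_abs ((T - t) * (g t).scalarCurvatureWith (cov t) x - 2)]
  push_cast
  nlinarith [hsq, h₂, sq_nonneg ((T - t) ^ δ)]

/-- **HELPER `helper_scaledChartBounds` — the order-zero chart bounds of the scaled flow**
(Hamilton 1982, §14, Lemma 14.2 and §17, Thm. 17.6, read in a chart). Along a Ricci flow of
Riemannian metrics on `[0, T)` on a closed 4-manifold with the two roundness rates on `[t₀, T)` and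
the scaled Shi bounds near `T`, for every point `z` and every closed ball `B̄(ẑ, r)` inside the
chart target at `z`, with `G = chartRep (𝓡 4) g z`, `b = Module.finBasis`: there are `λ > 0`, `C₀`
and limit forms `L(y)` such that on `B̄(ẑ, r) × [t₀, T)`
(i) `λ(T−t)|v|² ≤ G_t(y)(v,v)` and `‖G_t(y)‖ ≤ C₀(T−t)`;
(ii) `G_t(y)/(T−t) → L(y)` as `t ↑ T`, `L(y)` symmetric with `λ|v|² ≤ L(y)(v,v)`, and
`‖G_t(y)/(T−t) − L(y)‖ ≤ C₀ (T−t)^δ`;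
(iii) for every `k`, the components `(∇ᵏRic)_J` of `G_t` are bounded;
(iv) `|G_t(y)(v,w) − 2(T−t) Ric(G_t)(y)(v,w)| ≤ C₀ (T−t)^{1+δ}|v||w|`.
[cite: Hamilton1982, §14, Lemma 14.2] [cite: Hamilton1982, §17, Thm. 17.6]
[cite: Topping2006, §5.3, proof of Thm. 5.3.1, p. 47] -/
theorem helper_scaledChartBounds : ∀ (M : Type) [TopologicalSpace M] [T2Space M] [SecondCountableTopology M] [ChartedSpace (EuclideanSpace ℝ (Fin 4)) M] [IsManifold (𝓡 4) ∞ M] [CompactSpace M] (g : ℝ → PseudoRiemannianMetric (𝓡 4) ∞ (EuclideanSpace ℝ (Fin 4)) (TangentSpace (𝓡 4) : M → Type _)) (cov : ℝ → CovariantDerivative (𝓡 4) (EuclideanSpace ℝ (Fin 4)) (TangentSpace (𝓡 4) : M → Type _)) (T : ℝ), 0 < T → IsRicciFlow g cov (Ico 0 T) → (∀ t ∈ Ico 0 T, (g t).IsRiemannian) → ∀ (δ C t₀ : ℝ), 0 < δ → t₀ ∈ Ico 0 T → (∀ t ∈ Ico t₀ T, ∀ x : M, |(T - t) * (g t).scalarCurvatureWith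 (cov t) x - 2| ≤ C * (T - t) ^ δ ∧ (T - t) ^ 2 * ((g t).normSq x ((cov t).ricci x) - (g t).scalarCurvatureWith (cov t) x ^ 2 / 4) ≤ C * (T - t) ^ (2 * δ)) → (∀ k : ℕ, ∃ C' t₁ : ℝ, t₁ ∈ Ico 0 T ∧ ∀ t ∈ Ico t₁ T, ∀ z : M, curvDerivNormSq (𝓡 4) g k t z ≤ C' * ((T - t) ^ (k + 2))⁻¹) → ∀ (z : M) (r : ℝ), 0 ≤ r → closedBall (extChartAt (𝓡 4) z z) r ⊆ (extChartAt (𝓡 4) z).target → ∃ lam > (0 : ℝ), ∃ C₀ : ℝ, ∃ L : EuclideanSpace ℝ (Fin 4) → EuclideanSpace ℝ (Fin 4) →L[ℝ] EuclideanSpace ℝ (Fin 4) →L[ℝ] ℝ, (∀ y ∈ closedBall (extChartAt (𝓡 4) z z) r, Tendsto (fun t ↦ (T - t)⁻¹ • chartRep (𝓡 4) g z t y) (𝓝[<] T) (𝓝 (L y)) ∧ (∀ v w, L y v w = L y w v) ∧ (∀ v, lam * ‖v‖ ^ 2 ≤ L y v v) ∧ ∀ t ∈ Ico t₀ T, (∀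 v, lam * (T - t) * ‖v‖ ^ 2 ≤ chartRep (𝓡 4) g z t y v v) ∧ ‖chartRep (𝓡 4) g z t y‖ ≤ C₀ * (T - t) ∧ ‖(T - t)⁻¹ • chartRep (𝓡 4) g z t y - L y‖ ≤ C₀ * (T - t) ^ δ) ∧ (∀ k : ℕ, ∃ Ck : ℝ, ∀ t ∈ Ico t₀ T, ∀ y ∈ closedBall (extChartAt (𝓡 4) z z) r, ∀ J : Fin k ⊕ Fin 2 → Fin (finrank ℝ (EuclideanSpace ℝ (Fin 4))), |tcovIter (chartRep (𝓡 4) g z t) (Module.finBasis ℝ (EuclideanSpace ℝ (Fin 4))) k (ric2 (chartRep (𝓡 4) g z t) (Module.finBasis ℝ (EuclideanSpace ℝ (Fin 4)))) y J| ≤ Ck) ∧ (∀ t ∈ Ico t₀ T, ∀ y ∈ closedBall (extChartAt (𝓡 4) z z) r, ∀ v w : EuclideanSpace ℝ (Fin 4), |chartRep (𝓡 4) g z t y v w - 2 * (T - t) * ricAt (chartRep (𝓡 4) g z t) y v w| ≤ C₀ * (T - t) ^ (1 + δ) * ‖v‖ * ‖w‖) := by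
  intro M _ _ _ _ _ _ g cov T hT hflow hR δ C t₀ hδ ht₀ hrate hshi z r hr hcl
  -- the envelope `a(t) = (κ/δ)(T−t)^δ`
  have hκ0 : 0 ≤ Real.sqrt (C ^ 2 + 4 * C) := Real.sqrt_nonneg _
  set a : ℝ → ℝ := fun t ↦ Real.sqrt (C ^ 2 + 4 * C) / δ * (T - t) ^ δ with ha_def
  have ha : ∀ t ∈ Ico t₀ T, 0 ≤ a t ∧ a t ≤ a t₀ := fun t ht ↦
    ⟨mul_nonneg (div_nonneg hκ0 hδ.le) (rpow_nonneg (sub_pos.2 ht.2).le δ),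
      mul_le_mul_of_nonneg_left (rpow_le_rpow (sub_pos.2 ht.2).le (by linarith [ht.1]) hδ.le)
        (div_nonneg hκ0 hδ.le)⟩
  have ha0 : Tendsto a (𝓝[<] T) (𝓝 0) := by
    have hc : ContinuousAt (fun t : ℝ ↦ Real.sqrt (C ^ 2 + 4 * C) / δ * (T - t) ^ δ) T :=
      (ContinuousAt.rpow_const (f := fun t : ℝ ↦ T - t) (continuousAt_const.sub continuousAt_id)
        (Or.inr hδ.le)).const_mul _
    have h0 : a T = 0 := by simp [ha_def, sub_self, zero_rpow hδ.ne']
    rw [← h0]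
    exact hc.tendsto.mono_left nhdsWithin_le_nhds
  have henv : ∀ y ∈ closedBall (extChartAt (𝓡 4) z z) r, ∀ v : EuclideanSpace ℝ (Fin 4), ∃ ℓ : ℝ,
      Tendsto (fun s ↦ chartRep (𝓡 4) g z s y v v / (T - s)) (𝓝[<] T) (𝓝 ℓ) ∧ ∀ t ∈ Ico t₀ T,
      exp (-a t) * (chartRep (𝓡 4) g z t y v v / (T - t)) ≤ ℓ ∧
        ℓ ≤ exp (a t) * (chartRep (𝓡 4) g z t y v v / (T - t)) := by
    intro y _ v
    obtain ⟨gT, hlim, -, -, hbd⟩ :=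
      helper_scaledMetric_tendsto M g cov T hflow hR δ C t₀ hδ ht₀ hrate ((extChartAt (𝓡 4) z).symm y)
    simp only [chartRep_apply_eq_val]
    exact ⟨_, hlim _ _, fun t ht ↦ hbd t ht _⟩
  obtain ⟨lam, hlam, C₀, L, hL⟩ :=
    scaledChartRep_tendsto_of_envelope hflow.smooth hR ht₀ ha ha0 z hr hcl henv
  have hGup : ∀ t ∈ Ico t₀ T, ∀ y ∈ closedBall (extChartAt (𝓡 4) z z) r,
      ‖chartRep (𝓡 4) g z t y‖ ≤ C₀ * (T - t) := fun t ht y hy ↦ ((hL y hy).2.2.2 t ht).2.1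
  have hGlo : ∀ t ∈ Ico t₀ T, ∀ y ∈ closedBall (extChartAt (𝓡 4) z z) r, ∀ v : EuclideanSpace ℝ (Fin 4),
      lam * (T - t) * ‖v‖ ^ 2 ≤ chartRep (𝓡 4) g z t y v v := fun t ht y hy ↦ ((hL y hy).2.2.2 t ht).1
  -- velocity
  have hC : 0 ≤ C := by
    have h1 := (hrate t₀ ⟨le_rfl, ht₀.2⟩ z).1
    exact nonneg_of_mul_nonneg_left ((abs_nonneg _).trans h1) (rpow_pos_of_pos (sub_pos.2 ht₀.2) δ)
  have hK : 0 ≤ C ^ 2 + 4 * C := by positivity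
  have hvel := abs_chartRep_sub_two_mul_ricAt_le hflow hR ht₀ z hcl hGup hK
    (normSq_sub_two_mul_ricci_le hR ht₀ hrate)
  -- the common constant
  set C₁ : ℝ := max (max C₀ (C₀ * (Real.sqrt (C ^ 2 + 4 * C) / δ))) (Real.sqrt (C ^ 2 + 4 * C) * C₀) with hC₁
  refine ⟨lam, hlam, C₁, L, fun y hy ↦ ⟨(hL y hy).1, (hL y hy).2.1, (hL y hy).2.2.1, fun t ht ↦
    ⟨((hL y hy).2.2.2 t ht).1, ?_, ?_⟩⟩, fun k ↦ ?_, fun t ht y hy v w ↦ ?_⟩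
  · exact (hGup t ht y hy).trans (mul_le_mul_of_nonneg_right
      ((le_max_left _ _).trans (le_max_left _ _)) (sub_pos.2 ht.2).le)
  · refine ((hL y hy).2.2.2 t ht).2.2.trans ?_
    have hTt : 0 < T - t := sub_pos.2 ht.2
    calc C₀ * a t = C₀ * (Real.sqrt (C ^ 2 + 4 * C) / δ) * (T - t) ^ δ := by rw [ha_def]; ring
      _ ≤ C₁ * (T - t) ^ δ := mul_le_mul_of_nonneg_right
          ((le_max_right _ _).trans (le_max_left _ _)) (rpow_nonneg hTt.le δ)
  · obtain ⟨C', hC'⟩ := shi_uniform_time hflow hR ht₀ hshi k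
    exact abs_tcovIter_ric2_le_of_scaledShi hR ht₀ z hcl hGup hlam hGlo hC'
  · refine (hvel t ht y hy v w).trans ?_
    have hTt : 0 < T - t := sub_pos.2 ht.2
    have hnn : 0 ≤ (T - t) ^ (1 + δ) * ‖v‖ * ‖w‖ := by positivity
    calc Real.sqrt (C ^ 2 + 4 * C) * C₀ * (T - t) ^ (1 + δ) * ‖v‖ * ‖w‖
        = Real.sqrt (C ^ 2 + 4 * C) * C₀ * ((T - t) ^ (1 + δ) * ‖v‖ * ‖w‖) := by ring
      _ ≤ C₁ * ((T - t) ^ (1 + δ) * ‖v‖ * ‖w‖) := mul_le_mul_of_nonneg_right (le_max_right _ _) hnn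
      _ = _ := by ring

end Euclidean

end Summit.SmoothPoincare4.SmoothPoincare4.Theorems.MargerinRails

end
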